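import Literature.MathematicalPhysics.QuantumFieldTheory.CentralTwistVortexBound
import Literature.MathematicalPhysics.QuantumLattice.TwistedBoundaryConditions
import HarnessLib

/-!
# The flux is removed by a change of variables: twist locality and the strong-coupling vortex bound for EVERY central
# twist element (any order), with Ito–Seiler 2008 Theorem 2.2 (1) for `U(1)` with an arbitrary phase and for `SU(N)`

Topic `Literature/MathematicalPhysics/QuantumFieldTheory`; vocabulary of `CentralTwistPolymers.lean` (namespace `CentralTwist`:
`mulLinks`, `twistActivity`, `twistPolymerActivity`, `twistZ`), `CharacterActionPolymers.lean` (`sheetAt`, `jShiftLinks`, `iShiftLinks`),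
`TwistedPartitionFunction.lean` (`twistedPartitionFunction ρ β L z q`), `QuantumLattice/TwistedBoundaryConditions.lean` (`suCenter N k`,
the centre `Z_N ⊂ SU(N)`), `QuantumLattice/GaugeGroups.lean` (`u1Rep`, `fundamentalRep`). Small DEFINITIONS (integer link cochains)
and THEOREMS; no fact.

E. T. Tomboulis, arXiv:0707.2179 [Tomboulis2007Confinement] §6.2, text after (6.9): the flux "does not affect polymers that are wholly
contained in a simply connected part of `Λ`, since, in this case, the flux can be removed by a change of variables in the integrals
… Only clusters that contain at least one non-simply connected polymer forming a topologically non-trivially closed surface can be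
affected."  K. R. Ito, E. Seiler, arXiv:0803.3019 [ItoSeiler2008Further] §2 Thm 2.2 (1) ("`G = U(1)` or `G = SU(2)` … area decay
law"), the sentence after it ("The analogous statement for `SU(N)` holds with `Z⁻` replaced by `Z^ω`, the partition function twisted
by an element `ω` of the center of `SU(N)`") and Remark 2.1 (3) ("The center of `G = U(1)` is again `U(1)` … `U_ω(p) = exp(i(θ_p + ω))`").

The files `CentralTwistLocality.lean` / `CentralTwistVortexBound.lean` treat a central INVOLUTION `z` through the even/odd sector
expansion.  This file removes the order hypothesis altogether, following T07's sentence literally: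

* `cochainMul z η U` — the change of variables `U_b ↦ z^{η(b)} U_b` along an integer link cochain `η : Edge → ℤ`;
  `fluxInt η p` — its integer flux `δη(p)` through a plaquette; `plaquetteHolonomy_cochainMul`: for CENTRAL `z`,
  `U_p ↦ z^{δη(p)} U_p`; `measurePreserving_cochainMul`, `integral_comp_cochainMul` (Haar invariance);
* `fluxInt_indCochain_jShiftLinks = [𝒱_{a,b+1}] - [𝒱_{a,b}]`, `fluxInt_indCochain_iShiftLinks = [𝒱_{a,b}] - [𝒱_{a+1,b}]`,
  `pathCochain L a b i j` with `fluxInt_pathCochain = [𝒱_{a,b}] - [𝒱_{0,0}]` (telescoping);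
* `exists_sheetAt_disjoint` — pigeonhole: `|X| < L²` misses one of the `L²` disjoint parallel sheets (T07 (6.11));
* ★ `twistPolymerActivity_vortexSheet_eq_of_central` — `z^{(𝒱)}(X) = z(X)` for `|X| < L²`, ANY central `z`, any weight;
* ★ `one_sub_twistZ_div_le_of_central`, `one_sub_twistedPartitionFunction_div_le_of_central` — the bound
  `1 - Z^{(𝒱)}/Z ≤ 2d² L^{d-2} e^{-L²/2}` in the Kotecký–Preiss region, resp. for Wilson's action of a continuous `ρ` at
  `|β| ≤ 1/(4N (8(d-1)+1)² e²)`;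
* ★★ `u1_one_sub_twistedPartitionFunction_div_le_of_phase` (every `ω ∈ U(1)`), ★★ `sun_one_sub_twistedPartitionFunction_div_le`
  (every `N`, every centre element `e^{2πik/N}·𝟙 ∈ SU(N)`, fundamental Wilson action).

HONEST FRAMING: symmetric tori `(ℤ/Lℤ)^d` only (TODO(general form): the printed `L₃L₄ → ∞` at fixed `L₁L₂`); strong coupling
only; nothing about large `β`, (5.15)/(5.16) or any limit.
-/

noncomputable section

open MeasureTheory Finset
open scoped BigOperators
open Literature.MathematicalPhysics.QuantumLattice
open Literature.Probability.LatticeModels (IsRConnected GeomInc Touches)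

namespace Literature.MathematicalPhysics.QuantumFieldTheory

namespace CentralTwist

open Tomboulis2007

variable {d L : ℕ} {G : Type*} [Group G]

/-! ## Integer link cochains and the change of variables `U_b ↦ z^{η(b)} U_b` -/

section Cochains

/-- **The change of variables `U_b ↦ z^{η(b)} U_b`** along an integer link cochain `η` (for the indicator cochain of a
link set `E` this is `mulLinks z E`; negative values undo a multiplication). [cite: Tomboulis2007Confinement, §4 (text after (4.1))] -/
def cochainMul (z : G) (η : Edge d L → ℤ) (U : GaugeConfig d L G) : GaugeConfig d L G :=
  fun e => z ^ η e * U e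

/-- **The integer flux of a link cochain through a plaquette** `p = (x; i, j)`: `η(x,i) + η(x+eᵢ,j) - η(x+eⱼ,i) - η(x,j)`
(the boundary slots `(x,i)`, `(x+eᵢ,j)` are traversed forwards, `(x+eⱼ,i)`, `(x,j)` backwards; the cellular coboundary
`δη` of the torus with `ℤ` coefficients). [cite: Tomboulis2007Confinement, §4 (text after (4.1))] -/
def fluxInt (η : Edge d L → ℤ) (x : Site d L) (i j : Fin d) : ℤ :=
  η (x, i) + η (x.shift i, j) - η (x.shift j, i) - η (x, j)

/-- The indicator cochain of a link set. [cite: Tomboulis2007Confinement, §4 (text after (4.1))] -/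
def indCochain (E : Finset (Edge d L)) (e : Edge d L) : ℤ := if e ∈ E then 1 else 0

/-- Along the indicator cochain of `E` the change of variables is `mulLinks z E`.
[cite: Tomboulis2007Confinement, §4 (text after (4.1))] -/
theorem cochainMul_indCochain (z : G) (E : Finset (Edge d L)) (U : GaugeConfig d L G) :
    cochainMul z (indCochain E) U = mulLinks z E U := by
  funext e
  unfold cochainMul indCochain mulLinks linkMul
  split_ifs <;> simp

/-- Undoing the change of variables: `η` followed by `-η` is the identity. [cite: Tomboulis2007Confinement, §4 (text after (4.1))] -/
theorem cochainMul_neg_cochainMul (z : G) (η : Edge d L → ℤ) (U : GaugeConfig d L G) :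
    cochainMul z (-η) (cochainMul z η U) = U := by
  funext e
  simp only [cochainMul, Pi.neg_apply, zpow_neg, inv_mul_cancel_left]

/-- And `-η` followed by `η`. [cite: Tomboulis2007Confinement, §4 (text after (4.1))] -/
theorem cochainMul_cochainMul_neg (z : G) (η : Edge d L → ℤ) (U : GaugeConfig d L G) :
    cochainMul z η (cochainMul z (-η) U) = U := by
  funext e
  simp only [cochainMul, Pi.neg_apply, zpow_neg, mul_inv_cancel_left]

/-- **The transformed holonomy** for a CENTRAL `z` (no condition on its order): under `U_b ↦ z^{η(b)} U_b` the plaquette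
holonomy is multiplied by `z^{δη(p)}`. [cite: Tomboulis2007Confinement, §4 (text after (4.1))] -/
theorem plaquetteHolonomy_cochainMul {z : G} (hzc : ∀ g : G, z * g = g * z) (η : Edge d L → ℤ) (U : GaugeConfig d L G)
    (x : Site d L) (i j : Fin d) :
    plaquetteHolonomy (cochainMul z η U) x i j = z ^ fluxInt η x i j * plaquetteHolonomy U x i j := by
  have hc : ∀ (m : ℤ) (g : G), z ^ m * g = g * z ^ m := fun m g => (Commute.zpow_left (show Commute z g from hzc g) m).eq
  simp only [plaquetteHolonomy, cochainMul, mul_inv_rev]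
  rw [← zpow_neg, ← zpow_neg]
  set s₁ := z ^ η (x, i)
  set s₂ := z ^ η (x.shift i, j)
  set s₃ := z ^ (-η (x.shift j, i))
  set s₄ := z ^ (-η (x, j))
  have hpow : z ^ fluxInt η x i j = s₁ * s₂ * s₃ * s₄ := by
    simp only [fluxInt, sub_eq_add_neg, zpow_add, s₁, s₂, s₃, s₄]
  rw [hpow]
  have h₂ : ∀ V : G, s₂ * V = V * s₂ := hc _
  have h₃ : ∀ V : G, s₃ * V = V * s₃ := hc _
  have h₄ : ∀ V : G, s₄ * V = V * s₄ := hc _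
  calc s₁ * U (x, i) * (s₂ * U (x.shift i, j)) * ((U (x.shift j, i))⁻¹ * s₃) * ((U (x, j))⁻¹ * s₄)
      = s₁ * (U (x, i) * s₂) * U (x.shift i, j) * ((U (x.shift j, i))⁻¹ * s₃) * (U (x, j))⁻¹ * s₄ := by
        simp only [mul_assoc]
    _ = s₁ * (s₂ * U (x, i)) * U (x.shift i, j) * ((U (x.shift j, i))⁻¹ * s₃) * (U (x, j))⁻¹ * s₄ := by rw [h₂]
    _ = s₁ * s₂ * U (x, i) * U (x.shift i, j) * ((U (x.shift j, i))⁻¹ * s₃) * (U (x, j))⁻¹ * s₄ := by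
        simp only [mul_assoc]
    _ = s₁ * s₂ * U (x, i) * U (x.shift i, j) * (s₃ * (U (x.shift j, i))⁻¹) * (U (x, j))⁻¹ * s₄ := by rw [h₃]
    _ = s₁ * s₂ * (U (x, i) * U (x.shift i, j) * s₃) * (U (x.shift j, i))⁻¹ * (U (x, j))⁻¹ * s₄ := by
        simp only [mul_assoc]
    _ = s₁ * s₂ * (s₃ * (U (x, i) * U (x.shift i, j))) * (U (x.shift j, i))⁻¹ * (U (x, j))⁻¹ * s₄ := by rw [h₃]
    _ = s₁ * s₂ * s₃ * (U (x, i) * U (x.shift i, j) * (U (x.shift j, i))⁻¹ * (U (x, j))⁻¹ * s₄) := by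
        simp only [mul_assoc]
    _ = s₁ * s₂ * s₃ * (s₄ * (U (x, i) * U (x.shift i, j) * (U (x.shift j, i))⁻¹ * (U (x, j))⁻¹)) := by rw [h₄]
    _ = s₁ * s₂ * s₃ * s₄ * (U (x, i) * U (x.shift i, j) * (U (x.shift j, i))⁻¹ * (U (x, j))⁻¹) := by
        simp only [mul_assoc]

/-- Flux is additive in the cochain. [cite: Tomboulis2007Confinement, §4 (text after (4.1))] -/
theorem fluxInt_add (η η' : Edge d L → ℤ) (x : Site d L) (i j : Fin d) :
    fluxInt (η + η') x i j = fluxInt η x i j + fluxInt η' x i j := by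
  simp only [fluxInt, Pi.add_apply]; ring

/-- Flux of the negative cochain. [cite: Tomboulis2007Confinement, §4 (text after (4.1))] -/
theorem fluxInt_neg (η : Edge d L → ℤ) (x : Site d L) (i j : Fin d) : fluxInt (-η) x i j = -fluxInt η x i j := by
  simp only [fluxInt, Pi.neg_apply]; ring

/-- Flux of a difference. [cite: Tomboulis2007Confinement, §4 (text after (4.1))] -/
theorem fluxInt_sub (η η' : Edge d L → ℤ) (x : Site d L) (i j : Fin d) :
    fluxInt (η - η') x i j = fluxInt η x i j - fluxInt η' x i j := by
  simp only [fluxInt, Pi.sub_apply]; ring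

/-- Flux of a finite sum of cochains. [cite: Tomboulis2007Confinement, §4 (text after (4.1))] -/
theorem fluxInt_sum {ι : Type*} (s : Finset ι) (η : ι → Edge d L → ℤ) (x : Site d L) (i j : Fin d) :
    fluxInt (∑ t ∈ s, η t) x i j = ∑ t ∈ s, fluxInt (η t) x i j := by
  classical
  induction s using Finset.induction_on with
  | empty => simp [fluxInt]
  | insert a s ha ih => rw [Finset.sum_insert ha, Finset.sum_insert ha, fluxInt_add, ih]

section Haar

variable [TopologicalSpace G] [IsTopologicalGroup G] [CompactSpace G] [MeasurableSpace G] [BorelSpace G] [NeZero L]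

/-- **`U_b ↦ z^{η(b)} U_b` preserves the product Haar measure** (left translations, factorwise).
[cite: Tomboulis2007Confinement, §4 (text after (4.1))] -/
theorem measurePreserving_cochainMul (z : G) (η : Edge d L → ℤ) :
    MeasurePreserving (cochainMul z η)
      (Measure.pi fun _ : Edge d L => haarProbability G) (Measure.pi fun _ : Edge d L => haarProbability G) :=
  measurePreserving_pi (f := fun (e : Edge d L) (x : G) => z ^ η e * x)
    (fun _ : Edge d L => haarProbability G) (fun _ : Edge d L => haarProbability G)
    fun e => measurePreserving_mul_left (haarProbability G) (z ^ η e)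

/-- **Change of variables in a Haar integral**: `∫ F(z^η U) dU = ∫ F(U) dU` for every `F`.
[cite: Tomboulis2007Confinement, §4 (text after (4.1))] -/
theorem integral_comp_cochainMul (z : G) (η : Edge d L → ℤ) (F : GaugeConfig d L G → ℝ) :
    ∫ U, F (cochainMul z η U) ∂(Measure.pi fun _ : Edge d L => haarProbability G) =
      ∫ U, F U ∂(Measure.pi fun _ : Edge d L => haarProbability G) := by
  let e : GaugeConfig d L G ≃ᵐ GaugeConfig d L G :=
    { toFun := cochainMul z η
      invFun := cochainMul z (-η)
      left_inv := cochainMul_neg_cochainMul z η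
      right_inv := cochainMul_cochainMul_neg z η
      measurable_toFun := (measurePreserving_cochainMul z η).measurable
      measurable_invFun := (measurePreserving_cochainMul z (-η)).measurable }
  have hmp : MeasurePreserving e
      (Measure.pi fun _ : Edge d L => haarProbability G) (Measure.pi fun _ : Edge d L => haarProbability G) :=
    measurePreserving_cochainMul z η
  exact hmp.integral_comp' F

end Haar

end Cochains

/-! ## Moving the sheet by a cochain: the fluxes of the translation link sets, and the path cochain -/

section Sheets

variable [NeZero L]

omit [NeZero L] in
/-- `(x + e_k)_k = x_k + 1` (plumbing). [folklore] -/
private theorem shift_apply_same' (x : Site d L) (k : Fin d) : (x.shift k) k = x k + 1 := by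
  simp [Site.shift]

omit [NeZero L] in
/-- `(x + e_k)_l = x_l` for `l ≠ k` (plumbing). [folklore] -/
private theorem shift_apply_ne' (x : Site d L) {k l : Fin d} (h : l ≠ k) : (x.shift k) l = x l := by
  simp [Site.shift, h]

/-- The indicator cochain of `jShiftLinks` (plumbing). [folklore] -/
private theorem indCochain_jShiftLinks (a b : ZMod L) (i j : Fin d) (y : Site d L) (m : Fin d) :
    indCochain (jShiftLinks L a b i j) (y, m) = if m = i ∧ y i = a ∧ y j = b + 1 then 1 else 0 := by
  unfold indCochain
  exact if_congr mem_jShiftLinks rfl rfl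

/-- The indicator cochain of `iShiftLinks` (plumbing). [folklore] -/
private theorem indCochain_iShiftLinks (a b : ZMod L) (i j : Fin d) (y : Site d L) (m : Fin d) :
    indCochain (iShiftLinks L a b i j) (y, m) = if m = j ∧ y i = a + 1 ∧ y j = b then 1 else 0 := by
  unfold indCochain
  exact if_congr mem_iShiftLinks rfl rfl

variable (L) in
/-- **The integer flux of `jShiftLinks` is `[𝒱_{a,b+1}] - [𝒱_{a,b}]`**: multiplying the `i`-links at `(x_i, x_j) = (a, b+1)`
by `z` multiplies the holonomies of the `(i,j)`-plaquettes based at `(a, b+1)` by `z`, those based at `(a, b)` by `z⁻¹`, and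
no others (arXiv:0707.2179 §4: homologous coclosed sets "cobound a set of bonds"). [cite: Tomboulis2007Confinement, §4 (text after eq. (4.1))] -/
theorem fluxInt_indCochain_jShiftLinks (a b : ZMod L) {i j : Fin d} (hij : i < j) (p : Plaquette d L) :
    fluxInt (indCochain (jShiftLinks L a b i j)) p.1 p.2.1.1 p.2.1.2 =
      (if p ∈ sheetAt L a (b + 1) i j hij then 1 else 0) - (if p ∈ sheetAt L a b i j hij then 1 else 0) := by
  obtain ⟨x, ⟨⟨k, l⟩, hkl⟩⟩ := p
  have hkl' : k < l := hkl
  have hlk : l ≠ k := (ne_of_lt hkl').symm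
  simp only [mem_sheetAt, Subtype.mk.injEq, Prod.mk.injEq]
  by_cases hp : k = i ∧ l = j
  · obtain ⟨rfl, rfl⟩ := hp
    have hfc : fluxInt (indCochain (jShiftLinks L a b k l)) x k l =
        (if x k = a ∧ x l = b + 1 then 1 else 0) - (if x k = a ∧ x l = b then 1 else 0) := by
      simp only [fluxInt, indCochain_jShiftLinks, shift_apply_same', shift_apply_ne' x hlk, shift_apply_ne' x hlk.symm,
        true_and, hlk, false_and, if_false, add_zero, sub_zero, add_left_inj]
    rw [hfc]
    simp only [true_and]
  · have hR : ¬ ((k = i ∧ l = j) ∧ x i = a ∧ x j = b) := fun h => hp h.1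
    have hR' : ¬ ((k = i ∧ l = j) ∧ x i = a ∧ x j = b + 1) := fun h => hp h.1
    simp only [hR, hR', if_false, sub_zero]
    by_cases hk : k = i
    · subst hk
      have hl : l ≠ j := fun h => hp ⟨rfl, h⟩
      simp only [fluxInt, indCochain_jShiftLinks, shift_apply_ne' x hlk.symm, shift_apply_ne' x (Ne.symm hl),
        true_and, hlk, false_and, if_false, add_zero, sub_self]
    · by_cases hl : l = i
      · subst hl
        have hkj : k ≠ j := fun h => lt_asymm hij (h ▸ hkl')
        simp only [fluxInt, indCochain_jShiftLinks, shift_apply_ne' x hlk, shift_apply_ne' x (Ne.symm hkj),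
          true_and, hk, false_and, if_false, zero_add, sub_zero, sub_self]
      · simp only [fluxInt, indCochain_jShiftLinks, hk, hl, false_and, if_false, add_zero, sub_zero]

variable (L) in
/-- **The integer flux of `iShiftLinks` is `[𝒱_{a,b}] - [𝒱_{a+1,b}]`** (the `j`-links at `(x_i, x_j) = (a+1, b)`).
[cite: Tomboulis2007Confinement, §4 (text after eq. (4.1))] -/
theorem fluxInt_indCochain_iShiftLinks (a b : ZMod L) {i j : Fin d} (hij : i < j) (p : Plaquette d L) :
    fluxInt (indCochain (iShiftLinks L a b i j)) p.1 p.2.1.1 p.2.1.2 =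
      (if p ∈ sheetAt L a b i j hij then 1 else 0) - (if p ∈ sheetAt L (a + 1) b i j hij then 1 else 0) := by
  obtain ⟨x, ⟨⟨k, l⟩, hkl⟩⟩ := p
  have hkl' : k < l := hkl
  have hlk : l ≠ k := (ne_of_lt hkl').symm
  simp only [mem_sheetAt, Subtype.mk.injEq, Prod.mk.injEq]
  by_cases hp : k = i ∧ l = j
  · obtain ⟨rfl, rfl⟩ := hp
    have hfc : fluxInt (indCochain (iShiftLinks L a b k l)) x k l =
        (if x k = a ∧ x l = b then 1 else 0) - (if x k = a + 1 ∧ x l = b then 1 else 0) := by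
      simp only [fluxInt, indCochain_iShiftLinks, shift_apply_same', shift_apply_ne' x hlk, shift_apply_ne' x hlk.symm,
        true_and, hlk.symm, false_and, if_false, zero_add, sub_zero, add_left_inj]
    rw [hfc]
    simp only [true_and]
  · have hR : ¬ ((k = i ∧ l = j) ∧ x i = a ∧ x j = b) := fun h => hp h.1
    have hR' : ¬ ((k = i ∧ l = j) ∧ x i = a + 1 ∧ x j = b) := fun h => hp h.1
    simp only [hR, hR', if_false, sub_zero]
    by_cases hl : l = j
    · subst hl
      have hk : k ≠ i := fun h => hp ⟨h, rfl⟩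
      simp only [fluxInt, indCochain_iShiftLinks, shift_apply_ne' x hlk, shift_apply_ne' x (Ne.symm hk),
        true_and, hlk.symm, false_and, if_false, zero_add, sub_zero, sub_self]
    · by_cases hk : k = j
      · subst hk
        have hil : i ≠ l := ne_of_lt (hij.trans hkl')
        simp only [fluxInt, indCochain_iShiftLinks, shift_apply_ne' x hil, shift_apply_ne' x hlk.symm,
          true_and, hl, false_and, if_false, add_zero, sub_self]
      · simp only [fluxInt, indCochain_iShiftLinks, hk, hl, false_and, if_false, add_zero, sub_zero]

variable (L) in
/-- **The path cochain from `(0,0)` to `(a,b)`**: `-1` on the `j`-links at `(t+1, 0)`, `t < a`, and `+1` on the `i`-links at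
`(a, s+1)`, `s < b` (transverse coordinates read in `[0, L)`): its flux moves the sheet `𝒱_{0,0}` to `𝒱_{a,b}`
(`fluxInt_pathCochain`). [cite: Tomboulis2007Confinement, §4 (text after eq. (4.1))] -/
def pathCochain (a b : ZMod L) (i j : Fin d) : Edge d L → ℤ :=
  (∑ s ∈ Finset.range b.val, indCochain (jShiftLinks L a ((s : ℕ) : ZMod L) i j)) -
    ∑ t ∈ Finset.range a.val, indCochain (iShiftLinks L ((t : ℕ) : ZMod L) 0 i j)

variable (L) in
/-- **The flux of the path cochain is `[𝒱_{a,b}] - [𝒱_{0,0}]`** (telescoping the one-step fluxes).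
[cite: Tomboulis2007Confinement, §4 (text after eq. (4.1))] -/
theorem fluxInt_pathCochain (a b : ZMod L) {i j : Fin d} (hij : i < j) (p : Plaquette d L) :
    fluxInt (pathCochain L a b i j) p.1 p.2.1.1 p.2.1.2 =
      (if p ∈ sheetAt L a b i j hij then 1 else 0) - (if p ∈ sheetAt L 0 0 i j hij then 1 else 0) := by
  unfold pathCochain
  rw [fluxInt_sub, fluxInt_sum, fluxInt_sum]
  simp_rw [fluxInt_indCochain_jShiftLinks L _ _ hij, fluxInt_indCochain_iShiftLinks L _ _ hij]
  have hj : ∑ s ∈ Finset.range b.val,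
      ((if p ∈ sheetAt L a (((s : ℕ) : ZMod L) + 1) i j hij then (1 : ℤ) else 0) -
        (if p ∈ sheetAt L a ((s : ℕ) : ZMod L) i j hij then (1 : ℤ) else 0)) =
      (if p ∈ sheetAt L a b i j hij then (1 : ℤ) else 0) - (if p ∈ sheetAt L a 0 i j hij then (1 : ℤ) else 0) := by
    have h := Finset.sum_range_sub (fun s : ℕ => (if p ∈ sheetAt L a ((s : ℕ) : ZMod L) i j hij then (1 : ℤ) else 0))
      b.val
    simp only [Nat.cast_succ, ZMod.natCast_zmod_val, Nat.cast_zero] at h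
    exact h
  have hi : ∑ t ∈ Finset.range a.val,
      ((if p ∈ sheetAt L ((t : ℕ) : ZMod L) 0 i j hij then (1 : ℤ) else 0) -
        (if p ∈ sheetAt L (((t : ℕ) : ZMod L) + 1) 0 i j hij then (1 : ℤ) else 0)) =
      (if p ∈ sheetAt L 0 0 i j hij then (1 : ℤ) else 0) - (if p ∈ sheetAt L a 0 i j hij then (1 : ℤ) else 0) := by
    have h := Finset.sum_range_sub' (fun t : ℕ => (if p ∈ sheetAt L ((t : ℕ) : ZMod L) 0 i j hij then (1 : ℤ) else 0))
      a.val
    simp only [Nat.cast_succ, ZMod.natCast_zmod_val, Nat.cast_zero] at h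
    exact h
  rw [hj, hi]
  ring

/-- **Pigeonhole**: a plaquette set with fewer than `L²` plaquettes misses one of the `L²` pairwise disjoint parallel sheets
`𝒱_{a,b}` (arXiv:0707.2179 (6.11): a polymer affected by the flux has size at least `A = L₁L₂`).
[cite: Tomboulis2007Confinement, §6.2 eq. (6.11)] -/
theorem exists_sheetAt_disjoint {i j : Fin d} (hij : i < j) {X : Finset (Plaquette d L)} (hX : X.card < L ^ 2) :
    ∃ a b : ZMod L, Disjoint (sheetAt L a b i j hij) X := by
  by_contra h
  push Not at h
  have hex : ∀ ab : ZMod L × ZMod L, ∃ p, p ∈ X ∧ p ∈ sheetAt L ab.1 ab.2 i j hij := by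
    intro ab
    obtain ⟨p, hpV, hpX⟩ := Finset.not_disjoint_iff.1 (h ab.1 ab.2)
    exact ⟨p, hpX, hpV⟩
  choose f hfX hfV using hex
  have hinj : Function.Injective f := by
    intro ab ab' hff'
    by_contra hne
    have hne' : (ab.1, ab.2) ≠ (ab'.1, ab'.2) := by simpa [Prod.ext_iff] using hne
    have hdis := disjoint_sheetAt (L := L) hij hne'
    exact Finset.disjoint_left.1 hdis (hfV ab) (hff' ▸ hfV ab')
  have hcard : Fintype.card (ZMod L × ZMod L) ≤ Fintype.card X :=
    Fintype.card_le_of_injective (fun ab => (⟨f ab, hfX ab⟩ : X)) fun ab ab' h => hinj (congrArg Subtype.val h)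
  rw [Fintype.card_prod, ZMod.card, Fintype.card_coe] at hcard
  have : L ^ 2 = L * L := sq L
  omega

end Sheets

/-! ## Twist locality for EVERY central twist element: the flux is removed by a change of variables -/

section FluxRemoval

variable [TopologicalSpace G] [IsTopologicalGroup G] [CompactSpace G] [MeasurableSpace G] [BorelSpace G] [NeZero L]

open Literature.Probability.LatticeModels

/-- **Twist locality for a central `z` of any order** (arXiv:0707.2179 §6.2, text after (6.9): the flux "does not affect
polymers that are wholly contained in a simply connected part of `Λ`, since, in this case, the flux can be removed by a
change of variables in the integrals"): if `X` has fewer than `L²` plaquettes, some parallel sheet `𝒱_{a,b}` misses `X`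
(`exists_sheetAt_disjoint`), the change of variables along the path cochain (`fluxInt_pathCochain`) moves the twist from
`𝒱_{0,0}` to `𝒱_{a,b}`, and so `z^{(𝒱)}(X) = z(X)`. No hypothesis on the order of `z`, on `w`, or on measurability.
[cite: Tomboulis2007Confinement, §6.2 (text after eq. (6.9)) and eq. (6.11)] -/
theorem twistPolymerActivity_vortexSheet_eq_of_central {z : G} (hzc : ∀ g : G, z * g = g * z) (w : G → ℝ)
    {i j : Fin d} (hij : i < j) {X : Finset (Plaquette d L)} (hX : X.card < L ^ 2) :
    twistPolymerActivity z w (vortexSheet L i j hij) X = twistPolymerActivity z w ∅ X := by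
  by_cases hconn : IsRConnected linkRel X
  · obtain ⟨a, b, hab⟩ := exists_sheetAt_disjoint hij hX
    rw [twistPolymerActivity_of_isRConnected z hconn, twistPolymerActivity_of_isRConnected z hconn]
    congr 1
    have key : ∀ U : GaugeConfig d L G,
        ∏ p ∈ X, twistActivity z w (vortexSheet L i j hij) (cochainMul z (pathCochain L a b i j) U) p =
          ∏ p ∈ X, twistActivity z w ∅ U p := by
      intro U
      refine Finset.prod_congr rfl fun p hp => ?_
      have hpV : p ∉ sheetAt L a b i j hij := fun h => Finset.disjoint_left.1 hab h hp
      unfold twistActivity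
      rw [plaquetteHolonomy_cochainMul hzc, fluxInt_pathCochain L a b hij, if_neg hpV, if_neg (Finset.notMem_empty p),
        sheetAt_zero_zero hij]
      by_cases hp0 : p ∈ vortexSheet L i j hij
      · rw [if_pos hp0, if_pos hp0, zero_sub, zpow_neg, zpow_one, mul_inv_cancel_left]
      · rw [if_neg hp0, if_neg hp0, sub_zero, zpow_zero, one_mul]
    calc ∫ U, ∏ p ∈ X, twistActivity z w (vortexSheet L i j hij) U p ∂(Measure.pi fun _ : Edge d L => haarProbability G)
        = ∫ U, ∏ p ∈ X, twistActivity z w (vortexSheet L i j hij) (cochainMul z (pathCochain L a b i j) U) p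
            ∂(Measure.pi fun _ : Edge d L => haarProbability G) :=
          (integral_comp_cochainMul z (pathCochain L a b i j) _).symm
      _ = ∫ U, ∏ p ∈ X, twistActivity z w ∅ U p ∂(Measure.pi fun _ : Edge d L => haarProbability G) := by
          congr 1
          funext U
          exact key U
  · rw [twistPolymerActivity_of_not_isRConnected z hconn, twistPolymerActivity_of_not_isRConnected z hconn]

variable [SecondCountableTopology G]

omit [SecondCountableTopology G] in
/-- **(6.10) for every central twist element**: the Kotecký–Preiss logarithms of `Z^{(𝒱)}` and `Z` differ only by the
truncated functionals of clusters containing a polymer with at least `L²` plaquettes. [cite: Tomboulis2007Confinement, §6.2 eq. (6.10)] -/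
theorem polymerLogZ_sub_polymerLogZ_vortexSheet_eq_of_central {z : G} (hzc : ∀ g : G, z * g = g * z) (w : G → ℝ)
    {i j : Fin d} (hij : i < j) :
    polymerLogZ (GeomInc linkRel) (twistPolymerActivity z w ∅) (torusPolymers d L) -
        polymerLogZ (GeomInc linkRel) (twistPolymerActivity z w (vortexSheet L i j hij)) (torusPolymers d L) =
      ∑ C ∈ (torusPolymers d L).powerset with
          (C ∩ (torusPolymers d L).filter fun X => L ^ 2 ≤ X.card).Nonempty,
        (truncatedWeight (GeomInc linkRel) (twistPolymerActivity z w ∅) C -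
          truncatedWeight (GeomInc linkRel) (twistPolymerActivity z w (vortexSheet L i j hij)) C) := by
  refine polymerLogZ_sub_eq_sum_filter _ _ fun γ hγ hγT => ?_
  have hlt : γ.card < L ^ 2 := by
    by_contra h
    exact hγT (Finset.mem_filter.2 ⟨hγ, not_lt.1 h⟩)
  exact (twistPolymerActivity_vortexSheet_eq_of_central hzc w hij hlt).symm

/-- **The vortex free-energy bound, raw form, for every central twist element** (any second-countable compact group,
measurable weight in the Kotecký–Preiss region): `1 - Z^{(𝒱)}_w/Z_w ≤ 2 · #plaquettes · e^{-L²}`.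
[cite: Tomboulis2007Confinement, §6.2 eqs. (6.10)–(6.12)] [cite: ItoSeiler2008Further, §2 Thm 2.2 (1)] -/
theorem one_sub_twistZ_div_le_card_mul_exp_of_central {z : G} (hzc : ∀ g : G, z * g = g * z)
    {w : G → ℝ} (hw : Measurable w) {ε : ℝ} (hε : ∀ W, |w W - 1| ≤ ε)
    (hsmall : (((8 * (d - 1) : ℕ) : ℝ) + 1) ^ 2 * (Real.exp 2 * ε) ≤ 1 / 2) {i j : Fin d} (hij : i < j) :
    1 - twistZ d L z w (vortexSheet L i j hij) / twistZ d L z w ∅ ≤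
      2 * (Fintype.card (Plaquette d L) : ℝ) * Real.exp (-((L : ℝ) ^ 2)) := by
  have h1 := eps_lt_one_of_kpSmall (d := d) hε hsmall
  have hZ := twistZ_pos (d := d) (L := L) z hw hε h1 ∅
  have hZtw := twistZ_pos (d := d) (L := L) z hw hε h1 (vortexSheet L i j hij)
  have hratio : 0 < twistZ d L z w (vortexSheet L i j hij) / twistZ d L z w ∅ := div_pos hZtw hZ
  set ℓ₀ := polymerLogZ (GeomInc linkRel) (twistPolymerActivity z w ∅) (torusPolymers d L) with hℓ₀
  set ℓ₁ := polymerLogZ (GeomInc linkRel) (twistPolymerActivity z w (vortexSheet L i j hij)) (torusPolymers d L)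
    with hℓ₁
  have hlogZ : Real.log (twistZ d L z w ∅) = ℓ₀.re := log_twistZ_eq_re_polymerLogZ z hw hε hsmall ∅
  have hlogZtw : Real.log (twistZ d L z w (vortexSheet L i j hij)) = ℓ₁.re :=
    log_twistZ_eq_re_polymerLogZ z hw hε hsmall _
  calc 1 - twistZ d L z w (vortexSheet L i j hij) / twistZ d L z w ∅
      ≤ -Real.log (twistZ d L z w (vortexSheet L i j hij) / twistZ d L z w ∅) := by
        linarith [Real.log_le_sub_one_of_pos hratio]
    _ = Real.log (twistZ d L z w ∅) - Real.log (twistZ d L z w (vortexSheet L i j hij)) := by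
        rw [Real.log_div hZtw.ne' hZ.ne']
        ring
    _ = (ℓ₀ - ℓ₁).re := by rw [Complex.sub_re, hlogZ, hlogZtw]
    _ ≤ ‖ℓ₀ - ℓ₁‖ := Complex.re_le_norm _
    _ = ‖∑ C ∈ (torusPolymers d L).powerset with
            (C ∩ (torusPolymers d L).filter fun X => L ^ 2 ≤ X.card).Nonempty,
          (truncatedWeight (GeomInc linkRel) (twistPolymerActivity z w ∅) C -
            truncatedWeight (GeomInc linkRel) (twistPolymerActivity z w (vortexSheet L i j hij)) C)‖ := by
        rw [hℓ₀, hℓ₁, polymerLogZ_sub_polymerLogZ_vortexSheet_eq_of_central hzc w hij]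
    _ ≤ ∑ C ∈ (torusPolymers d L).powerset with
            (C ∩ (torusPolymers d L).filter fun X => L ^ 2 ≤ X.card).Nonempty,
          (‖truncatedWeight (GeomInc linkRel) (twistPolymerActivity z w ∅) C‖ +
            ‖truncatedWeight (GeomInc linkRel) (twistPolymerActivity z w (vortexSheet L i j hij)) C‖) :=
        (norm_sum_le _ _).trans (Finset.sum_le_sum fun C _ => norm_sub_le _ _)
    _ ≤ (Fintype.card (Plaquette d L) : ℝ) * Real.exp (-((L : ℝ) ^ 2)) +
          (Fintype.card (Plaquette d L) : ℝ) * Real.exp (-((L : ℝ) ^ 2)) := by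
        rw [Finset.sum_add_distrib]
        have hl : ∀ C ∈ (torusPolymers d L).powerset.filter (fun C =>
            (C ∩ (torusPolymers d L).filter fun X => L ^ 2 ≤ X.card).Nonempty),
            ∃ X ∈ C, X ∈ torusPolymers d L ∧ L ^ 2 ≤ X.card := by
          intro C hC
          obtain ⟨X, hX⟩ := (Finset.mem_filter.1 hC).2
          rw [Finset.mem_inter, Finset.mem_filter] at hX
          exact ⟨X, hX.1, hX.2.1, hX.2.2⟩
        exact add_le_add (sum_norm_truncatedWeight_le_of_large_twist z hε hsmall ∅ _ hl)
          (sum_norm_truncatedWeight_le_of_large_twist z hε hsmall (vortexSheet L i j hij) _ hl)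
    _ = 2 * (Fintype.card (Plaquette d L) : ℝ) * Real.exp (-((L : ℝ) ^ 2)) := by ring

omit [TopologicalSpace G] [IsTopologicalGroup G] [CompactSpace G] [MeasurableSpace G] [BorelSpace G]
  [SecondCountableTopology G] in
/-- `#plaquettes ≤ d² L^d` (plumbing). [folklore] -/
private theorem card_plaquette_le'' : (Fintype.card (Plaquette d L) : ℝ) ≤ (d : ℝ) ^ 2 * (L : ℝ) ^ d := by
  classical
  have h : Fintype.card (Plaquette d L) ≤ d ^ 2 * L ^ d := by
    rw [Fintype.card_prod]
    have hS : Fintype.card (Site d L) = L ^ d := by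
      rw [Fintype.card_pi, Finset.prod_const, ZMod.card, Finset.card_univ, Fintype.card_fin]
    have hP : Fintype.card {p : Fin d × Fin d // p.1 < p.2} ≤ d ^ 2 := by
      refine (Fintype.card_subtype_le _).trans ?_
      rw [Fintype.card_prod, Fintype.card_fin, sq]
    rw [hS, mul_comm]
    exact Nat.mul_le_mul_right _ hP
  exact_mod_cast h

omit [TopologicalSpace G] [IsTopologicalGroup G] [CompactSpace G] [MeasurableSpace G] [BorelSpace G]
  [SecondCountableTopology G] [NeZero L] in
/-- `x ≤ e^{x/2}` for `x ≥ 0` (plumbing). [folklore] -/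
private theorem le_exp_half'' {x : ℝ} (hx : 0 ≤ x) : x ≤ Real.exp (x / 2) := by
  have h := Real.add_one_le_exp (x / 4)
  have h2 : Real.exp (x / 2) = Real.exp (x / 4) ^ 2 := by
    rw [← Real.exp_nat_mul]; ring_nf
  rw [h2]
  nlinarith [sq_nonneg (1 - x / 4), Real.exp_pos (x / 4)]

omit [TopologicalSpace G] [IsTopologicalGroup G] [CompactSpace G] [MeasurableSpace G] [BorelSpace G]
  [SecondCountableTopology G] [NeZero L] in
/-- `L^d e^{-L²} ≤ L^{d-2} e^{-L²/2}` for `d ≥ 2` (plumbing). [folklore] -/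
private theorem pow_mul_exp_neg_sq_le'' (hd : 2 ≤ d) (L : ℕ) :
    (L : ℝ) ^ d * Real.exp (-((L : ℝ) ^ 2)) ≤ (L : ℝ) ^ (d - 2) * Real.exp (-(1 / 2 * (L : ℝ) ^ 2)) := by
  have hL2 : (0 : ℝ) ≤ (L : ℝ) ^ 2 := by positivity
  have hx := le_exp_half'' hL2
  have hsplit : (L : ℝ) ^ d = (L : ℝ) ^ (d - 2) * (L : ℝ) ^ 2 := by
    rw [← pow_add, Nat.sub_add_cancel hd]
  have hexp : Real.exp (-((L : ℝ) ^ 2)) = Real.exp (-(1 / 2 * (L : ℝ) ^ 2)) * Real.exp (-((L : ℝ) ^ 2 / 2)) := by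
    rw [← Real.exp_add]; ring_nf
  rw [hsplit, hexp]
  have hkey : (L : ℝ) ^ 2 * Real.exp (-((L : ℝ) ^ 2 / 2)) ≤ 1 := by
    rw [Real.exp_neg]
    have hpos := Real.exp_pos ((L : ℝ) ^ 2 / 2)
    rw [mul_inv_le_iff₀ hpos, one_mul]
    exact hx
  have hnn : 0 ≤ (L : ℝ) ^ (d - 2) * Real.exp (-(1 / 2 * (L : ℝ) ^ 2)) := by positivity
  calc (L : ℝ) ^ (d - 2) * (L : ℝ) ^ 2 * (Real.exp (-(1 / 2 * (L : ℝ) ^ 2)) * Real.exp (-((L : ℝ) ^ 2 / 2)))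
      = ((L : ℝ) ^ (d - 2) * Real.exp (-(1 / 2 * (L : ℝ) ^ 2))) * ((L : ℝ) ^ 2 * Real.exp (-((L : ℝ) ^ 2 / 2))) := by
        ring
    _ ≤ ((L : ℝ) ^ (d - 2) * Real.exp (-(1 / 2 * (L : ℝ) ^ 2))) * 1 := mul_le_mul_of_nonneg_left hkey hnn
    _ = (L : ℝ) ^ (d - 2) * Real.exp (-(1 / 2 * (L : ℝ) ^ 2)) := mul_one _

/-- **The strong-coupling vortex bound for every compact gauge group, every CENTRAL twist element and every plaquette
weight near `1`** (second-countable compact `G`; `z ∈ Z(G)` of any order — e.g. every `e^{iω} ∈ U(1)`, every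
`e^{2πik/N}·𝟙 ∈ SU(N)`; measurable `w : G → ℝ` with `(8(d-1)+1)² e² sup|w - 1| ≤ 1/2`): on every symmetric torus
`(ℤ/Lℤ)^d` and every plane, `1 - Z^{(𝒱)}_w/Z_w ≤ 2 d² L^{d-2} e^{-L²/2}` (arXiv:0707.2179 §6.2; IS08 Thm 2.2 (1) and
"the analogous statement for `SU(N)` holds with `Z⁻` replaced by `Z^ω`"; Osterwalder–Seiler 1978 §3).
[cite: Tomboulis2007Confinement, §6.2 eqs. (6.10)–(6.14)] [cite: ItoSeiler2008Further, §2 Thm 2.2 (1)] -/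
theorem one_sub_twistZ_div_le_of_central {z : G} (hzc : ∀ g : G, z * g = g * z)
    {w : G → ℝ} (hw : Measurable w) {ε : ℝ} (hε : ∀ W, |w W - 1| ≤ ε)
    (hsmall : (((8 * (d - 1) : ℕ) : ℝ) + 1) ^ 2 * (Real.exp 2 * ε) ≤ 1 / 2) {i j : Fin d} (hij : i < j) :
    1 - twistZ d L z w (vortexSheet L i j hij) / twistZ d L z w ∅ ≤
      2 * (d : ℝ) ^ 2 * (L : ℝ) ^ (d - 2) * Real.exp (-(1 / 2 * (L : ℝ) ^ 2)) := by
  have hd : 2 ≤ d := by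
    have hi := i.isLt
    have hj := j.isLt
    have : (i : ℕ) < j := hij
    omega
  calc 1 - twistZ d L z w (vortexSheet L i j hij) / twistZ d L z w ∅
      ≤ 2 * (Fintype.card (Plaquette d L) : ℝ) * Real.exp (-((L : ℝ) ^ 2)) :=
        one_sub_twistZ_div_le_card_mul_exp_of_central hzc hw hε hsmall hij
    _ ≤ 2 * ((d : ℝ) ^ 2 * (L : ℝ) ^ d) * Real.exp (-((L : ℝ) ^ 2)) :=
        mul_le_mul_of_nonneg_right (mul_le_mul_of_nonneg_left card_plaquette_le'' (by norm_num))
          (Real.exp_nonneg _)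
    _ = 2 * (d : ℝ) ^ 2 * ((L : ℝ) ^ d * Real.exp (-((L : ℝ) ^ 2))) := by ring
    _ ≤ 2 * (d : ℝ) ^ 2 * ((L : ℝ) ^ (d - 2) * Real.exp (-(1 / 2 * (L : ℝ) ^ 2))) :=
        mul_le_mul_of_nonneg_left (pow_mul_exp_neg_sq_le'' hd L) (by positivity)
    _ = 2 * (d : ℝ) ^ 2 * (L : ℝ) ^ (d - 2) * Real.exp (-(1 / 2 * (L : ℝ) ^ 2)) := by ring

/-- **Ito–Seiler 2008 Theorem 2.2 (1) for every second-countable compact gauge group and every central twist element,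
symmetric tori**: for a continuous representation `ρ : G →* M_N(ℂ)`, Wilson's action `β Σ_p (N - Re tr ρ(U_p))`, `z ∈ Z(G)`
and `|β| ≤ β₁(d, N) = 1/(4N (8(d-1)+1)² e²)`: on every torus `(ℤ/Lℤ)^d` and every plane `(i, j)`,
`1 - Z_{β,L}(z)/Z_{β,L}(𝟙) ≤ 2d² L^{d-2} e^{-L²/2}`. TODO(general form): asymmetric tori `L₃L₄ → ∞`.
[cite: ItoSeiler2008Further, §2 Thm 2.2 (1)] [cite: Tomboulis2007Confinement, §6.2 eqs. (6.10)–(6.14)] -/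
theorem one_sub_twistedPartitionFunction_div_le_of_central {N : ℕ} {z : G} (hzc : ∀ g : G, z * g = g * z)
    (ρ : G →* Matrix (Fin N) (Fin N) ℂ) (hρ : Continuous ρ) {β : ℝ}
    (hβ : |β| ≤ 1 / (4 * N * ((((8 * (d - 1) : ℕ) : ℝ) + 1) ^ 2 * Real.exp 2))) {i j : Fin d} (hij : i < j) :
    1 - twistedPartitionFunction ρ β L z ⟨(i, j), hij⟩ / twistedPartitionFunction ρ β L 1 ⟨(i, j), hij⟩ ≤
      2 * (d : ℝ) ^ 2 * (L : ℝ) ^ (d - 2) * Real.exp (-(1 / 2 * (L : ℝ) ^ 2)) := by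
  have hK : (1 : ℝ) ≤ (((8 * (d - 1) : ℕ) : ℝ) + 1) ^ 2 * Real.exp 2 := by
    have hD : (1 : ℝ) ≤ (((8 * (d - 1) : ℕ) : ℝ) + 1) ^ 2 := by
      have : (0 : ℝ) ≤ ((8 * (d - 1) : ℕ) : ℝ) := Nat.cast_nonneg _
      nlinarith
    have he : (1 : ℝ) ≤ Real.exp 2 := Real.one_le_exp (by norm_num)
    nlinarith
  have hNβ : (N : ℝ) * |β| * (4 * ((((8 * (d - 1) : ℕ) : ℝ) + 1) ^ 2 * Real.exp 2)) ≤ 1 := by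
    rcases Nat.eq_zero_or_pos N with hN | hN
    · simp [hN]
    · have hNpos : (0 : ℝ) < N := by exact_mod_cast hN
      have hden : (0 : ℝ) < 4 * N * ((((8 * (d - 1) : ℕ) : ℝ) + 1) ^ 2 * Real.exp 2) := by positivity
      have h := hβ
      rw [le_div_iff₀ hden] at h
      linarith
  have hNβ1 : (N : ℝ) * |β| ≤ 1 := by
    have : (N : ℝ) * |β| * 4 ≤ (N : ℝ) * |β| * (4 * ((((8 * (d - 1) : ℕ) : ℝ) + 1) ^ 2 * Real.exp 2)) := by
      have h0 : 0 ≤ (N : ℝ) * |β| := by positivity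
      nlinarith
    linarith
  have hε : ∀ W : G, |Real.exp (β * ((ρ W).trace).re) - 1| ≤ 2 * N * |β| :=
    abs_exp_mul_re_trace_sub_one_le ρ hρ hNβ1
  have hsmall : (((8 * (d - 1) : ℕ) : ℝ) + 1) ^ 2 * (Real.exp 2 * (2 * N * |β|)) ≤ 1 / 2 := by
    nlinarith [abs_nonneg β]
  rw [twistedPartitionFunction_div_eq_twistZ_div ρ β z hij]
  exact one_sub_twistZ_div_le_of_central hzc (measurable_exp_mul_re_trace ρ hρ β) hε hsmall hij

end FluxRemoval

/-! ### `U(1)` with an arbitrary twist phase, and `SU(N)` with a centre element -/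

section Instances

/-- **Ito–Seiler 2008 Theorem 2.2 (1) for `G = U(1)` with an ARBITRARY twist phase** (Remark 2.1 (3): "The center of
`G = U(1)` is again `U(1)`. Then we consider `U(p) = exp(iθ_p)` and `U_ω(p) = exp(i(θ_p + ω))` for `p ∈ 𝒱`"), symmetric tori:
for every `ω ∈ U(1)` and `|β| ≤ 1/(4 (8(d-1)+1)² e²)`, `1 - Z^ω_{β,L}/Z_{β,L} ≤ 2d² L^{d-2} e^{-L²/2}`.
[cite: ItoSeiler2008Further, §2 Thm 2.2 (1) and Remark 2.1 (3)] -/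
theorem u1_one_sub_twistedPartitionFunction_div_le_of_phase [MeasurableSpace Circle] [BorelSpace Circle] (d : ℕ)
    (ω : Circle) {β : ℝ} (hβ : |β| ≤ 1 / (4 * ((((8 * (d - 1) : ℕ) : ℝ) + 1) ^ 2 * Real.exp 2))) {L : ℕ} [NeZero L]
    {i j : Fin d} (hij : i < j) :
    1 - twistedPartitionFunction u1Rep β L ω ⟨(i, j), hij⟩ / twistedPartitionFunction u1Rep β L 1 ⟨(i, j), hij⟩ ≤
      2 * (d : ℝ) ^ 2 * (L : ℝ) ^ (d - 2) * Real.exp (-(1 / 2 * (L : ℝ) ^ 2)) := by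
  have hβ' : |β| ≤ 1 / (4 * (1 : ℕ) * ((((8 * (d - 1) : ℕ) : ℝ) + 1) ^ 2 * Real.exp 2)) := by
    simpa using hβ
  exact one_sub_twistedPartitionFunction_div_le_of_central (fun g => mul_comm ω g) u1Rep continuous_u1Rep hβ' hij

/-- **Ito–Seiler 2008 Theorem 2.2 (1), `SU(N)` form, symmetric tori** ("The analogous statement for `SU(N)` holds with
`Z⁻` replaced by `Z^ω`, the partition function twisted by an element `ω` of the center of `SU(N)`"): for every `N`, every
centre element `e^{2πik/N}·𝟙` (`suCenter N k` of `TwistedBoundaryConditions.lean`), the fundamental Wilson action and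
`|β| ≤ 1/(4N (8(d-1)+1)² e²)`: `1 - Z^ω_{β,L}/Z_{β,L} ≤ 2d² L^{d-2} e^{-L²/2}` on every torus `(ℤ/Lℤ)^d` and plane.
[cite: ItoSeiler2008Further, §2 Thm 2.2 (1) (text after the theorem)] [cite: tHooft1979Flux, §2 (2.2)] -/
theorem sun_one_sub_twistedPartitionFunction_div_le (d N : ℕ) (k : ZMod N) {β : ℝ}
    (hβ : |β| ≤ 1 / (4 * N * ((((8 * (d - 1) : ℕ) : ℝ) + 1) ^ 2 * Real.exp 2))) {L : ℕ} [NeZero L]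
    {i j : Fin d} (hij : i < j) :
    1 - twistedPartitionFunction (fundamentalRep (Fin N)) β L
          (suCenter N k : Matrix.specialUnitaryGroup (Fin N) ℂ) ⟨(i, j), hij⟩ /
        twistedPartitionFunction (fundamentalRep (Fin N)) β L 1 ⟨(i, j), hij⟩ ≤
      2 * (d : ℝ) ^ 2 * (L : ℝ) ^ (d - 2) * Real.exp (-(1 / 2 * (L : ℝ) ^ 2)) := by
  haveI : SecondCountableTopology (Matrix (Fin N) (Fin N) ℂ) :=
    inferInstanceAs (SecondCountableTopology (Fin N → Fin N → ℂ))
  haveI : SecondCountableTopology (Matrix.specialUnitaryGroup (Fin N) ℂ) :=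
    TopologicalSpace.Subtype.secondCountableTopology _
  have hzc : ∀ g : Matrix.specialUnitaryGroup (Fin N) ℂ,
      (suCenter N k : Matrix.specialUnitaryGroup (Fin N) ℂ) * g = g * (suCenter N k : Matrix.specialUnitaryGroup (Fin N) ℂ) :=
    fun g => (Subgroup.mem_center_iff.1 (suCenter N k).2 g).symm
  exact one_sub_twistedPartitionFunction_div_le_of_central hzc (fundamentalRep (Fin N)) (continuous_fundamentalRep (Fin N))
    hβ hij

end Instances

end CentralTwist

end Literature.MathematicalPhysics.QuantumFieldTheory

end
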